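import Mathlib
import Summits.MatrixMultiplication.MatrixMultiplication.Theses.SnSubsetDichotomy
import Summits.MatrixMultiplication.MatrixMultiplication.Theorems.SnSubsetDichotomyHyperoctahedralSubsets
import Summits.MatrixMultiplication.MatrixMultiplication.Theorems.HyperoctahedralThreshold.Negative.HyperoctahedralThresholdFalseOfLocalTriplePacking

/-!
# Refutation of the crux `SnSubsetDichotomy.HyperoctahedralThreshold` (stmt-MatrixMultiplication-10883)

`HyperoctahedralThreshold` — THE CONSTRUCTION side of the knife edge: for every `c > 0` and `n₀` some `n ≥ n₀`, three
fixed-point-free involutions `μ_i` of `Fin n` and subsets `X_i ⊆ C(μ_i) ≅ S_2 ≀ S_{n/2}` with the triple product property and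
`|X₀||X₁||X₂| > (n!)^{3/2}·e^{−c√n}` — is FALSE.  It is literally `¬ HyperoctahedralSubsets` (push-neg), and the sibling crux
`HyperoctahedralSubsets` (stmt-MatrixMultiplication-8305) is now a tree theorem (`hyperoctahedralSubsets_proof`): group packing over
a product-one triple group of order `2^{√n/4}` (`hyperoctahedralSubsets_of_localTriplePacking`, p118938, this crux's negative lemma)
fed by the matching lemma (L′) `localTriplePacking_holds` — every triple of perfect matchings of `Fin n` carries `≥ √n/4` commuting
local triples with pairwise disjoint supports — which assembles the landed stubs of this crux's refutation line
`Cruxes/HyperoctahedralThreshold/Lines/refutation_local_symmetry.lean` (gadget zoo p88731 p88744 p90070, extraction p90186,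
rich-word descent p99339 p98890, pattern twins p107640, packing p88618, and the atom `stub_poorRigidCore` p131375, proved by the
clean-pair depth recursion of `…CleanPairFinal`).  The one-line composition below is this crux's deciding NEGATIVE edge:
`LocalTriplePacking → ¬ HyperoctahedralThreshold` (`hyperoctahedralThreshold_false_of_localTriplePacking`) at
`localTriplePacking_holds`.  (The registered skeleton of the line, with its last `sorry` replaced by the tree theorem, elaborates to
the same conclusion: `Cruxes/HyperoctahedralThreshold/Lines/refutation_local_symmetry.lean`, lead c5 check 2026-08-17, axioms
`propext`, `Classical.choice`, `Quot.sound`.)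

Classification (for the planner): `refuted-substantive`.  The load-bearing claim — TPP triples of slack `e^{−o(√n)}` inside three
hyperoctahedral matching centralisers — is false for EVERY choice of matchings and subsets; there is no side condition to repair: any
host family in which it held would prove `ω(ℂ) = 2` through `closes`, and the same local-triple packing bound applies to every triple
of perfect matchings.  The route's construction crux must move to other hosts (the target `ThresholdSubsetTriples` itself stays open).
-/

/-- **Record of the dropped route item `HyperoctahedralThreshold`** = stmt-MatrixMultiplication-10883 (ledger signature verbatim; NOT a route
item): route SnSubsetDichotomy rev 5 (2026-08-17T02:16Z) dropped the refuted `HyperoctahedralThreshold`. The declaration `Summit.MatrixMultiplication.MatrixMultiplication.Theses.SnSubsetDichotomy.HyperoctahedralThreshold`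
therefore no longer exists in the route file and this accepted module stopped elaborating (stale olean;
buildfix lane 2026-08-19). Re-created here under its original name so the result keeps building; the
statement of every previously accepted declaration in this file is unchanged. -/
def _root_.Summit.MatrixMultiplication.MatrixMultiplication.Theses.SnSubsetDichotomy.HyperoctahedralThreshold : Prop :=
  ∀ c : ℝ, 0 < c → ∀ n₀ : ℕ, ∃ n ≥ n₀, ∃ μ : Fin 3 → Equiv.Perm (Fin n), (∀ i, μ i * μ i = 1 ∧ ∀ x, μ i x ≠ x) ∧ ∃ X : Fin 3 → Finset (Equiv.Perm (Fin n)), (∀ i, ∀ σ ∈ X i, σ * μ i = μ i * σ) ∧ Literature.Combinatorics.Additive.TripleProductProperty (X 0) (X 1) (X 2) ∧ (n.factorial : ℝ) ^ ((3 : ℝ) / 2) * Real.exp (-(c * Real.sqrt (n : ℝ))) < (((X 0).card * (X 1).card * (X 2).card : ℕ) : ℝ)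


-- the tree's namespace `Summit.MatrixMultiplication.MatrixMultiplication.…` repeats a component by design
set_option linter.dupNamespace false

namespace Summit.MatrixMultiplication.MatrixMultiplication.Theorems

/-- **`¬ HyperoctahedralThreshold`** (crux stmt-MatrixMultiplication-10883 of route `SnSubsetDichotomy`, REFUTED — substantive):
there is `c > 0` (indeed any `c` below the packing constant of `hyperoctahedralSubsets_of_localTriplePacking` at `(L′)`-constant
`1/4`) such that for all large `n` NO triple of fixed-point-free involutions of `Fin n` hosts a TPP triple of subsets of their
centralisers with `|X₀||X₁||X₂| > (n!)^{3/2} e^{−c√n}`.  Proof: the matching lemma `localTriplePacking_holds` (≥ `√n/4` disjoint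
commuting local triples in every host) and the conditional refutation `hyperoctahedralThreshold_false_of_localTriplePacking`
(group packing, p118938).  No cheap repair exists: the bound holds for all matchings and all subsets, and any surviving host family
would give `ω(ℂ) = 2` via `closes`. [this line] -/
theorem not_HyperoctahedralThreshold :
    ¬ Summit.MatrixMultiplication.MatrixMultiplication.Theses.SnSubsetDichotomy.HyperoctahedralThreshold :=
  HyperoctahedralThreshold.Negative.hyperoctahedralThreshold_false_of_localTriplePacking
    HyperoctahedralSubsets.localTriplePacking_holds

end Summit.MatrixMultiplication.MatrixMultiplication.Theorems
-- buildfix 2026-08-20 (bf3-g6): enqueue-only re-land — rebuild this module (and, as its dependency, Theorems/SnSubsetDichotomyHyperoctahedralSubsets)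
-- after the root …HyperoctahedralThreshold/Negative/HyperoctahedralThresholdFalseOfLocalTriplePacking was repaired (p217061); no content change.
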